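import Mathlib
import HarnessLib
import Literature.MathematicalPhysics.QuantumLattice.FermiRG.BGM2003Sectors
import Summits.HubbardSuperconductivity.HubbardSuperconductivity.Theorems.KLProgrammeH10TwoPointLimitFrameSectorCell
import Summits.HubbardSuperconductivity.HubbardSuperconductivity.Theorems.KLProgrammeH10TwoPointLimitPerturbedCell
import Summits.HubbardSuperconductivity.HubbardSuperconductivity.Theorems.KLProgrammePerturbedFermiCurveDefs

/-!
# Route `KLProgramme` — K3 engine child `KLRegimeEngineV17F2` (stmt-HubbardSuperconductivity-20437), stub (b) `(Hμ)` re-sectorisation: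
# THE SUPPORT OF THE ENGINE'S SECTOR MULTIPLIER LIES IN BGM 2003's s-SECTOR OF THE FRAME'S CHART (same scale, same index, shell `e₀`)

Cell gate-hubbard-kl, seat p4 (C5a), g12; brick (E) of the keyed off-class relative count «KEYED-R1-OFFCLASS».  BGM 2003's sector counting
Lemma 3.1 is proved in the tree on the s-sectors `BGM2003.sSector u e₀ n ω = {u(θ,e)e⃗_r(θ) : |e| ≤ 4^{−n}e₀, ζ_{n,ω}(θ) ≠ 0}` of a polar CHART `u`
(for the frames: `u θ e = perturbedFermiRadius δ_K (μ + e) θ`, `…FrameBGM2003SectorCountingUniform`), while the engine's labels live on the torus: a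
label `ω` of `klAnisoFamily L M β μ K e₀ n` constrains a lattice momentum through `bgmMultiplier` (shell `|e_K| < e₀4^{−n}`, angular weight
`ζ_{n,ω}` at the polar angle of the CENTRED representative).  This file identifies the two: the centred representative `c(k⃗) ∈ [−π, π]²` of a
momentum carrying `klAnisoFamily … n ω` IS the chart point `u(θ, e)e⃗_r(θ)` with `θ = arg c(k⃗)`, `e = e_K(c(k⃗))`, hence lies in
`BGM2003.sSector u e₀ n ω` — by ray-wise uniqueness of the frame's Fermi radius (`eq_perturbedFermiRadius_of_isBandFermiRadius`) at the level
`μ + e`, for frames of `C²` size `A` with `2A < Dt_min` and shells inside the level range (`a ≤ μ − A − e₀`, `μ + A + e₀ ≤ b`):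

* `rep_eq_levelPoint_chart` — `c(k⃗) = levelPoint u (arg c(k⃗)) (e_K(c(k⃗)))` for every momentum of the closed square in the shell;
* **`rep_mem_sSector2003_of_klAnisoFamily`** — `klAnisoFamily L M β μ K e₀ n ω k ≠ 0 ⇒ c(k⃗) ∈ BGM2003.sSector u e₀ n ω`.

Everything is PROVED; no definitions, no named facts.  References: BGM 2006 §2.5 (2.45)–(2.48), §2.7 (2.69) [cite: BenfattoGiulianiMastropietro2006];
BGM 2003 §2.6 (3.44a) [cite: BenfattoGiulianiMastropietro2003].
-/

noncomputable section

namespace Summit.HubbardSuperconductivity.HubbardSuperconductivity.Theorems.PerturbedFermiCurve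

set_option linter.dupNamespace false -- summit = problem name (single-conjunct summit), D-0017

open Classical
open Real Set
open Literature.MathematicalPhysics.QuantumLattice Literature.MathematicalPhysics.QuantumLattice.BandSectorCounting
open Literature.MathematicalPhysics.QuantumLattice.FermiRG
open Literature.Probability.LatticeModels
open Summit.HubbardSuperconductivity.HubbardSuperconductivity.Theorems.DispersionFlow
open Summit.HubbardSuperconductivity.HubbardSuperconductivity.Theorems.KLRegimeSplit
open Summit.HubbardSuperconductivity.HubbardSuperconductivity.Theorems.KLProgrammeLegKernels

/-! ## §1 A point of the closed square in the frame's shell is a chart point -/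

section Frame

variable {a b : ℝ} (B : BandBounds a b) {K : TrigPolyC4v} {A : ℝ}
  (hA : ∀ p : Momentum, ∀ j ≤ 2, ‖iteratedFDeriv ℝ j (frameShift K) p‖ ≤ A) (hADt : 2 * A < B.Dtmin) {μ : ℝ}
include B hA hADt

omit B hA hADt in
/-- `klScale e₀ n = 4^{−n}·e₀`. [folklore] -/
theorem klScale_eq_zpow_mul (e₀ : ℝ) (n : ℕ) : klScale e₀ n = (4 : ℝ) ^ (-(n : ℤ)) * e₀ := by
  rw [klScale, zpow_neg, zpow_natCast, mul_comm]

/-- **A momentum of the closed square in the frame's shell is a point of the frame's chart**: if `|c_i| ≤ π` and the level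
`e := e_K(c) = ε₀(c) + δ_K(c) − μ` has `μ + e ± A` inside `[a, b]`, then `c = u(θ, e)·e⃗_r(θ)` with `θ = arg c` and
`u ϑ e = perturbedFermiRadius δ_K (μ + e) ϑ`. [cite: BenfattoGiulianiMastropietro2006, §2.7 (2.69)] -/
theorem rep_eq_levelPoint_chart {c : Fin 2 → ℝ} (hc : ∀ i, |c i| ≤ π)
    (hlo : a ≤ μ + frameLevel μ K (WithLp.toLp 2 c) - A) (hhi : μ + frameLevel μ K (WithLp.toLp 2 c) + A ≤ b) :
    c = BGM2003.levelPoint (fun ϑ e => perturbedFermiRadius (fun k : Fin 2 → ℝ => frameShift K (WithLp.toLp 2 k)) (μ + e) ϑ)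
      (Complex.arg (⟨c 0, c 1⟩ : ℂ)) (frameLevel μ K (WithLp.toLp 2 c)) := by
  set δ : (Fin 2 → ℝ) → ℝ := fun k => frameShift K (WithLp.toLp 2 k) with hδdef
  set e := frameLevel μ K (WithLp.toLp 2 c) with hedef
  set φ := Complex.arg (⟨c 0, c 1⟩ : ℂ) with hφdef
  have hA0 : 0 ≤ A := le_trans (norm_nonneg _) (hA 0 0 (by norm_num))
  -- the perturbation's size and radial Lipschitz bound on the closed square
  have hδ : ∀ k : Fin 2 → ℝ, (∀ i, |k i| ≤ π) → |δ k| ≤ A := fun k _ => abs_frameShift_toLp_le hA k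
  have hL : ∀ s t : ℝ, s ∈ Icc 0 (π / ‖dir φ‖) → t ∈ Icc 0 (π / ‖dir φ‖) → |δ (s • dir φ) - δ (t • dir φ)| ≤ 2 * A * |s - t| :=
    radialLipschitz_of_fderiv_le (fun k _ => (differentiable_frameShift_toLp K) k) (fun k _ => norm_fderiv_frameShift_toLp_le hA k) φ
  -- the level of `c` for the FREE band
  have he : e = sqDispersion c + δ c - μ := by rw [hedef, frameLevel_toLp]
  have hν : sqDispersion c ∈ Icc a b := by
    have h1 := abs_le.1 (hδ c hc)
    constructor <;> linarith [h1.1, h1.2]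
  -- `c` is the free Fermi point of its own level on its ray
  set t := bandFermiRadius (sqDispersion c) φ with htdef
  have hct : c = t • dir φ := by
    have h := eq_bandFermiRadius_smul_dir_of_mem_square B hc hν 0
    simpa [hφdef, htdef] using h
  have hνa : -4 < sqDispersion c := B.ha.trans_le hν.1
  have hνb : sqDispersion c < 0 := hν.2.trans_lt B.hb
  have ht : IsBandFermiRadius (sqDispersion c) φ t := isBandFermiRadius_bandFermiRadius hνa hνb φ
  -- hence a Fermi point of `ε₀ + δ_K` at the level `μ + e`
  have ht' : IsBandFermiRadius (μ + e - δ (t • dir φ)) φ t := by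
    have : μ + e - δ (t • dir φ) = sqDispersion c := by rw [← hct, he]; ring
    rw [this]; exact ht
  have hlo' : a ≤ μ + e - A := hlo
  have hhi' : μ + e + A ≤ b := hhi
  have huniq := eq_perturbedFermiRadius_of_isBandFermiRadius B (continuous_frameShift_toLp K) hδ hlo' hhi' hL hADt ht'
  rw [BGM2003.levelPoint]
  show c = perturbedFermiRadius δ (μ + e) φ • dir φ
  rw [← huniq]; exact hct

/-! ## §2 The support of `klAnisoFamily` in BGM 2003's s-sectors -/

/-- **The centred representative of a momentum carrying `klAnisoFamily … n ω` lies in `BGM2003.sSector u e₀ n ω`** (`u` the chart of the frame at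
`μ`, shell `e₀`, same scale and index), for frames of `C²` size `A` with `2A < Dt_min` and the shell inside the level range.
[cite: BenfattoGiulianiMastropietro2006, §2.7 (2.69); BenfattoGiulianiMastropietro2003, §2.6 (3.44a)] -/
theorem rep_mem_sSector2003_of_klAnisoFamily (L M : ℕ) [NeZero L] {e₀ : ℝ} (he : 0 < e₀) (β : ℝ) (n : ℕ)
    (hlo : a ≤ μ - A - e₀) (hhi : μ + A + e₀ ≤ b) {ω : Fin (sectorCount n)} {k : FreqMomentum L M}
    (hk : klAnisoFamily L M β μ K e₀ n ω k ≠ 0) :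
    torusCentredMomentum L k.2 ∈
      BGM2003.sSector (fun ϑ e => perturbedFermiRadius (fun k : Fin 2 → ℝ => frameShift K (WithLp.toLp 2 k)) (μ + e) ϑ) e₀ n (ω : ℕ) := by
  obtain ⟨h1, -, h3⟩ := support_klAnisoFamily L M he β μ K n ω k hk
  rw [nambuXiCT_eq_frameLevel] at h1
  rw [momentumAngle_eq_arg] at h3
  set c := torusCentredMomentum L k.2 with hcdef
  have hc : ∀ i, |c i| ≤ π := abs_torusCentredMomentum_le_pi L k.2
  -- the shell: `|e| < Λ_n = 4^{−n} e₀ ≤ e₀`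
  have hsc : klScale e₀ n ≤ e₀ := by
    rw [klScale_eq_zpow_mul]
    exact mul_le_of_le_one_left he.le (zpow_le_one_of_nonpos₀ (by norm_num) (by simp))
  have he' : |frameLevel μ K (WithLp.toLp 2 c)| ≤ (4 : ℝ) ^ (-(n : ℤ)) * e₀ := by
    rw [← klScale_eq_zpow_mul]; exact h1.le
  have hel := abs_le.1 (h1.le.trans hsc)
  refine ⟨Complex.arg (⟨c 0, c 1⟩ : ℂ), frameLevel μ K (WithLp.toLp 2 c), he', ?_, ?_⟩
  · exact_mod_cast h3
  · exact rep_eq_levelPoint_chart B hA hADt hc (by linarith [hel.1]) (by linarith [hel.2])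

end Frame

end Summit.HubbardSuperconductivity.HubbardSuperconductivity.Theorems.PerturbedFermiCurve

end
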